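/-
Copyright (c) 2026 the pub-hodgecm-mathlib formalisation cell (harness21).  R90-TF SLAB, section S10 (Rogawski 1990, §13.6–13.8 read at `v`),
prover R90-C138-p07 (g0) — card W1-H4′ (a) (DEAL #4 (g2) (5), RULING J-F-2′ 2026-09-04); h413 = `stmt-HodgeConjecture-24833`, route `HCCMUnconditional`.
-/
import Literature.NumberTheory.Automorphic.HeckeOperatorUnitaryAdjoint    -- ★ `exists_bound_fixedPointsAlgHom`, `exists_adjoint_fixedPointsAlgHom` (D-0151 (U2))
import Literature.NumberTheory.Automorphic.LocalUnitaryIntegralLevel      -- ★ `cmDatum`, `cmLocalIntegralLevel`, `isCompact_isOpen_cmLocalIntegralLevel`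
import HarnessLib

/-!
# R90-TF ∕ S10 — W1-H4′ (a): THE PINS OF RECORD `bd`, `σ` on the unramified Hecke algebras (RULING J-F-2′)
# (`Theorems/R90S10GermPinsOfRecordDefs.lean`; ns `Summit.HodgeConjecture.HodgeConjecture.R90.S10`; definitions + their API, no instance, no notation)

Print: [Rogawski1990] §13.6 p. 209 «`t = {t_v}` … `t_v` is a homomorphism of the Hecke algebra `𝓗_v` in `ℂ`»; §10.3 p. 159 «the `z_j` are contained in a compact
subset» (boundedness of the e.v.p.'s of UNITARY representations); §13.7 p. 213 (Langlands' separation uses `f ↦ f^*` and bounded packages).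
[DeitmarEchterhoff2014] Prop. 6.2.1 «`π(f)^* = π(f^*)`, `‖π(f)‖ ≤ ‖f‖₁`» for unitary `π`.

## WHY (RULING J-F-2′, R90-C138-plan (g2), R90 bus 2026-09-04): FILE F (`Cruxes/H413/Lines/R90_S10_TwistedDatumF.lean` :87–:94) types the germ space
`GermSub S bd σ = {t : EigenvaluePackage S 𝓗 ∕∕ (∀ i x, ‖t i x‖ ≤ bd i x) ∧ ∀ i x, t i (σ i x) = conj (t i x)}` over PARAMETERS
`bd : ∀ i ∉ S, 𝓗_i → ℝ`, `σ : ∀ i ∉ S, 𝓗_i → 𝓗_i` (with the side condition `hσ : ∀ i, σ i 1 = 1`), and S5-D's `Hrec` ∕ D ED. 3 quantify over them;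
the obligation `hRepGerm` «every `t(c)`, `c` a discrete class, lies in `GermSub S bd σ`» (F :182) is unprovable for parametric `bd σ`.  THIS FILE PINS THE
INSTANCE OF RECORD, generic over any Hecke pair `(G, K)` (Mathlib `IsHeckeTriple ⊤ K K`):
* `heckeBoundOfRecord K x := M(op x)` — the uniform bound of ★ `exists_bound_fixedPointsAlgHom` («`‖π(x)‖ ≤ M(x)` on `V^K` for EVERY representation with
  an invariant positive-definite Hermitian form»; on generators `M(T_g) = #(KgK∕K)`), with `heckeBoundOfRecord_nonneg`, `heckeBoundOfRecord_spec`;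
* `heckeStarOfRecord K x := (op x)†` — the adjoint of ★ `exists_adjoint_fixedPointsAlgHom` («`B(x·e, y) = B(e, x†·y)` on `V^K` for EVERY representation
  with an invariant form»; on generators `T_g† = (d_g∕d_{g⁻¹}) T_{g⁻¹}`), PATCHED AT `x = 1` to `1` so that F's side condition `σ 1 = 1` is TRUE
  (`heckeStarOfRecord_one`; harmless: any adjoint of `1` acts as `1` on `V^K`), with `heckeStarOfRecord_spec`;
* the CM instances at the integral levels `K_v = U(H)(𝒪_v)` off `S` (★ `cmLocalIntegralLevel`): `bdRec L H S`, `σRec L H S` — EXACTLY the types of F's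
  parameters `bd`, `σ` (`HeckeAt L v = heckeAlgebra ℂ ((cmDatum L 3 H).Local v) (cmLocalIntegralLevel L 3 H v)` at `H = splitForm L 3`) — and
  `σRec_one : ∀ i, σRec L H S i 1 = 1` = S5-D's conjunct `hσ` ∕ D ED. 3's `hσ`, DISCHARGED.
The universe of the representation spaces is pinned to `Type` (= ★ `SmoothIrrep.V`), so that the specs apply to every representative of every ★ `IrrClass`.
CONSUMER: `Theorems/R90S10GermOfRecordMem.lean` (W1-H4′ (b)): `germOfDiscreteClass S c ∈ GermSub S (bdRec …) (σRec …)` for EVERY discrete class `c`.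
HONEST LABEL: definitions (two `Classical.choose` pins + CM instances) and their specs; closes nothing; HC_CM is proved only modulo the 7 printed citations
(2 remaining named inputs: hLiu418 = `stmt-HodgeConjecture-24832`, h413 = `stmt-HodgeConjecture-24833`) until rung 0 closes; REL ≠ ★ ≠ BUILT.
-/

set_option autoImplicit false
set_option linter.dupNamespace false

noncomputable section

open NumberField IsDedekindDomain
open Literature.NumberTheory.Automorphic Literature.NumberTheory.Automorphic.UnitaryGroup

namespace Summit.HodgeConjecture.HodgeConjecture.R90.S10

universe u

/-! ## §1 Generic Hecke pair: the bound of record and the star of record -/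

section Generic

variable {G : Type u} [Group G] (K : Subgroup G) [IsHeckeTriple (⊤ : Submonoid G) K K]

/-- ★ `exists_bound_fixedPointsAlgHom` with the representation spaces in `Type` (the universe of ★ `SmoothIrrep.V`): every `a ∈ ℋ(G,K)ᵐᵒᵖ` has `M ≥ 0` with
`re B(a·x, a·x) ≤ M² · re B(x, x)` on `V^K` for every representation with an invariant positive-definite Hermitian form. [cite: DeitmarEchterhoff2014, Prop. 6.2.1] -/
theorem exists_bound_fixedPointsAlgHom₀ (a : (heckeAlgebra ℂ G K)ᵐᵒᵖ) :
    ∃ M : ℝ, 0 ≤ M ∧ ∀ {V : Type} [AddCommGroup V] [Module ℂ V] (ρ : Representation ℂ G V)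
      (B : V →ₗ⋆[ℂ] V →ₗ[ℂ] ℂ), B.IsSymm → (∀ v : V, v ≠ 0 → 0 < (B v v).re) →
      (∀ (g : G) (x y : V), B (ρ g x) (ρ g y) = B x y) →
      ∀ x : ρ.fixedPoints K,
        (B (heckeAlgebra.fixedPointsAlgHom K ρ a x : V) (heckeAlgebra.fixedPointsAlgHom K ρ a x : V)).re ≤ M ^ 2 * (B (x : V) x).re :=
  exists_bound_fixedPointsAlgHom K a

/-- ★ `exists_adjoint_fixedPointsAlgHom` with the representation spaces in `Type`: every `a ∈ ℋ(G,K)ᵐᵒᵖ` has an adjoint `a†` on the `K`-fixed vectors of every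
representation with an invariant sesquilinear form. [cite: DeitmarEchterhoff2014, Prop. 6.2.1] -/
theorem exists_adjoint_fixedPointsAlgHom₀ (a : (heckeAlgebra ℂ G K)ᵐᵒᵖ) :
    ∃ a' : (heckeAlgebra ℂ G K)ᵐᵒᵖ, ∀ {V : Type} [AddCommGroup V] [Module ℂ V] (ρ : Representation ℂ G V)
      (B : V →ₗ⋆[ℂ] V →ₗ[ℂ] ℂ), (∀ (g : G) (x y : V), B (ρ g x) (ρ g y) = B x y) →
      ∀ x y : ρ.fixedPoints K,
        B (heckeAlgebra.fixedPointsAlgHom K ρ a x : V) y = B x (heckeAlgebra.fixedPointsAlgHom K ρ a' y : V) :=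
  exists_adjoint_fixedPointsAlgHom K a

/-- **THE BOUND OF RECORD `bd(x) := M(op x)`** — a uniform operator bound of `x ∈ ℋ(G, K)` on the `K`-fixed vectors of EVERY unitarizable representation
(«`‖π(f)‖ ≤ ‖f‖₁`»; the pin `bd` of F's `GermSub`). [cite: DeitmarEchterhoff2014, Prop. 6.2.1] [cite: Rogawski1990, §10.3 p. 159] -/
def heckeBoundOfRecord (x : heckeAlgebra ℂ G K) : ℝ :=
  (exists_bound_fixedPointsAlgHom₀ K (MulOpposite.op x)).choose

/-- `0 ≤ bd(x)`. [cite: DeitmarEchterhoff2014, Prop. 6.2.1] -/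
theorem heckeBoundOfRecord_nonneg (x : heckeAlgebra ℂ G K) : 0 ≤ heckeBoundOfRecord K x :=
  (exists_bound_fixedPointsAlgHom₀ K (MulOpposite.op x)).choose_spec.1

/-- **SPEC of the bound of record**: `re B(x·e, x·e) ≤ bd(x)² · re B(e, e)` for every `K`-fixed `e` of every representation with an invariant positive-definite
Hermitian form `B`. [cite: DeitmarEchterhoff2014, Prop. 6.2.1] -/
theorem heckeBoundOfRecord_spec (x : heckeAlgebra ℂ G K) {V : Type} [AddCommGroup V] [Module ℂ V] (ρ : Representation ℂ G V)
    (B : V →ₗ⋆[ℂ] V →ₗ[ℂ] ℂ) (hBs : B.IsSymm) (hpos : ∀ v : V, v ≠ 0 → 0 < (B v v).re) (hB : ∀ (g : G) (x y : V), B (ρ g x) (ρ g y) = B x y)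
    (e : ρ.fixedPoints K) :
    (B (heckeAlgebra.fixedPointsAlgHom K ρ (MulOpposite.op x) e : V) (heckeAlgebra.fixedPointsAlgHom K ρ (MulOpposite.op x) e : V)).re ≤
      heckeBoundOfRecord K x ^ 2 * (B (e : V) e).re :=
  (exists_bound_fixedPointsAlgHom₀ K (MulOpposite.op x)).choose_spec.2 ρ B hBs hpos hB e

open scoped Classical in
/-- **THE STAR OF RECORD `σ(x) := (op x)†`** — an adjoint of `x ∈ ℋ(G, K)` on the `K`-fixed vectors of EVERY representation with an invariant form
(«`π(f)^* = π(f^*)`»; the pin `σ` of F's `GermSub`), patched at `x = 1` to `1` (F's side condition `σ 1 = 1`). [cite: DeitmarEchterhoff2014, Prop. 6.2.1]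
[cite: Rogawski1990, §13.7 p. 213] -/
def heckeStarOfRecord (x : heckeAlgebra ℂ G K) : heckeAlgebra ℂ G K :=
  if x = 1 then 1 else MulOpposite.unop (exists_adjoint_fixedPointsAlgHom₀ K (MulOpposite.op x)).choose

/-- **`σ(1) = 1`** (F's `hσ`, by the patch). [cite: Rogawski1990, §13.7 p. 213] -/
theorem heckeStarOfRecord_one : heckeStarOfRecord K (1 : heckeAlgebra ℂ G K) = 1 := by
  rw [heckeStarOfRecord, if_pos rfl]

/-- **SPEC of the star of record**: `B(x·e, y) = B(e, σ(x)·y)` for all `K`-fixed `e, y` of every representation with an invariant sesquilinear form `B`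
(at `x = 1` both sides are `B(e, y)`). [cite: DeitmarEchterhoff2014, Prop. 6.2.1] -/
theorem heckeStarOfRecord_spec (x : heckeAlgebra ℂ G K) {V : Type} [AddCommGroup V] [Module ℂ V] (ρ : Representation ℂ G V)
    (B : V →ₗ⋆[ℂ] V →ₗ[ℂ] ℂ) (hB : ∀ (g : G) (x y : V), B (ρ g x) (ρ g y) = B x y) (e y : ρ.fixedPoints K) :
    B (heckeAlgebra.fixedPointsAlgHom K ρ (MulOpposite.op x) e : V) y =
      B e (heckeAlgebra.fixedPointsAlgHom K ρ (MulOpposite.op (heckeStarOfRecord K x)) y : V) := by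
  by_cases hx : x = 1
  · subst hx
    rw [heckeStarOfRecord_one, MulOpposite.op_one, map_one, Module.End.one_apply, Module.End.one_apply]
  · rw [heckeStarOfRecord, if_neg hx, MulOpposite.op_unop]
    exact (exists_adjoint_fixedPointsAlgHom₀ K (MulOpposite.op x)).choose_spec ρ B hB e y

end Generic

/-! ## §2 The CM instances at the integral levels off `S` (the types of F's parameters `bd`, `σ`) -/

section CM

variable (L : Type) [Field L] [NumberField L] [IsCMField L] (H : Matrix (Fin 3) (Fin 3) L)
  (S : Set (HeightOneSpectrum (𝓞 ↥(maximalRealSubfield L))))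

/-- `(U(H)(L⁺_v), U(H)(𝒪_v))` is a Hecke pair: the integral level is compact open (★ `isCompact_isOpen_cmLocalIntegralLevel`), hence of finite index in each
of its conjugates (★ `isHeckeTriple_top_of_isCompact_isOpen`).  A theorem, used through `haveI` (no instance is declared). [cite: Rogawski1990, §13.6 p. 209] -/
theorem isHeckeTriple_cmLocalIntegralLevel (v : HeightOneSpectrum (𝓞 ↥(maximalRealSubfield L))) :
    IsHeckeTriple (⊤ : Submonoid ((cmDatum L 3 H).Local v)) (cmLocalIntegralLevel L 3 H v) (cmLocalIntegralLevel L 3 H v) :=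
  isHeckeTriple_top_of_isCompact_isOpen _ (isCompact_isOpen_cmLocalIntegralLevel L 3 H v).1 (isCompact_isOpen_cmLocalIntegralLevel L 3 H v).2

/-- **`bdRec L H S` — THE BOUND OF RECORD off `S`** (F's parameter `bd`, instantiated): `bdRec i x := heckeBoundOfRecord (U(H)(𝒪_i)) x`.
[cite: Rogawski1990, §10.3 p. 159; §13.6 p. 209] -/
def bdRec : ∀ i : {i : HeightOneSpectrum (𝓞 ↥(maximalRealSubfield L)) // i ∉ S},
    heckeAlgebra ℂ ((cmDatum L 3 H).Local i.1) (cmLocalIntegralLevel L 3 H i.1) → ℝ :=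
  fun i x => haveI := isHeckeTriple_cmLocalIntegralLevel L H i.1; heckeBoundOfRecord (cmLocalIntegralLevel L 3 H i.1) x

/-- **`σRec L H S` — THE STAR OF RECORD off `S`** (F's parameter `σ`, instantiated): `σRec i x := heckeStarOfRecord (U(H)(𝒪_i)) x`.
[cite: Rogawski1990, §13.7 p. 213] -/
def σRec : ∀ i : {i : HeightOneSpectrum (𝓞 ↥(maximalRealSubfield L)) // i ∉ S},
    heckeAlgebra ℂ ((cmDatum L 3 H).Local i.1) (cmLocalIntegralLevel L 3 H i.1) →
      heckeAlgebra ℂ ((cmDatum L 3 H).Local i.1) (cmLocalIntegralLevel L 3 H i.1) :=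
  fun i x => haveI := isHeckeTriple_cmLocalIntegralLevel L H i.1; heckeStarOfRecord (cmLocalIntegralLevel L 3 H i.1) x

/-- Unfolding `bdRec`. [cite: Rogawski1990, §10.3 p. 159] -/
theorem bdRec_apply (i : {i : HeightOneSpectrum (𝓞 ↥(maximalRealSubfield L)) // i ∉ S})
    (x : heckeAlgebra ℂ ((cmDatum L 3 H).Local i.1) (cmLocalIntegralLevel L 3 H i.1)) :
    bdRec L H S i x = (haveI := isHeckeTriple_cmLocalIntegralLevel L H i.1; heckeBoundOfRecord (cmLocalIntegralLevel L 3 H i.1) x) :=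
  rfl

/-- Unfolding `σRec`. [cite: Rogawski1990, §13.7 p. 213] -/
theorem σRec_apply (i : {i : HeightOneSpectrum (𝓞 ↥(maximalRealSubfield L)) // i ∉ S})
    (x : heckeAlgebra ℂ ((cmDatum L 3 H).Local i.1) (cmLocalIntegralLevel L 3 H i.1)) :
    σRec L H S i x = (haveI := isHeckeTriple_cmLocalIntegralLevel L H i.1; heckeStarOfRecord (cmLocalIntegralLevel L 3 H i.1) x) :=
  rfl

/-- **`σRec i 1 = 1` for every `i ∉ S`** — F's side condition `hσ : ∀ i, σ i 1 = 1` (S5-D's `Hrec` conjunct, D ED. 3's `hσ`) DISCHARGED at the star of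
record. [cite: Rogawski1990, §13.7 p. 213] -/
theorem σRec_one : ∀ i : {i : HeightOneSpectrum (𝓞 ↥(maximalRealSubfield L)) // i ∉ S}, σRec L H S i 1 = 1 :=
  fun i => by
    haveI := isHeckeTriple_cmLocalIntegralLevel L H i.1
    exact heckeStarOfRecord_one (cmLocalIntegralLevel L 3 H i.1)

end CM

end Summit.HodgeConjecture.HodgeConjecture.R90.S10

end
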